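import Literature.Barriers.Schanuel.NesterenkoModularScopeCriterionProofs
import Literature.NumberTheory.EllipticCurves.EisensteinValuesAtI
import Literature.NumberTheory.EllipticCurves.ModularFormsRamanujan
import HarnessLib

/-!
# Barrier (Schanuel) `NesterenkoModularScope`: the values `P(e^{−2π}) = 3/π`, `Q(e^{−2π}) = 3Γ(1/4)⁸/(2π)⁶`, `R(e^{−2π}) = 0` — discharge of `ramanujan_values_exp_neg_two_pi` (proofs only)

`Literature/Barriers/Schanuel/NesterenkoModularScopeValuesProofs.lean` — sibling proofs file of
`Literature/Barriers/Schanuel/NesterenkoModularScope.lean`. No new definitions. It DISCHARGES the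
named fact `ramanujan_values_exp_neg_two_pi` (Nesterenko–Philippon, LNM 1752, Ch. 3 §1 p. 27:
"Take `q = e^{−2π}`. Then `P(q) = 3/π`, `Q(q) = 3Γ(1/4)⁸/(2π)⁶`, `R(q) = 0`, see Chapter 1"), the
second input — next to Theorem 1.1 (`nesterenko1996_thm_1_1`) — of the proved reduction
`nesterenko_of_thm_1_1` giving Corollary 1.2, the tree's
`Literature.NumberTheory.Transcendental.nesterenko` (`π, e^π, Γ(1/4)` algebraically independent,
**periods.S16**).

* `ramanujanP_cexp`, `ramanujanQ_cexp`, `ramanujanR_cexp` — **PROVED**: the printed identities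
  `E₂(τ) = P(e^{2πiτ})`, `E₄(τ) = Q(e^{2πiτ})`, `E₆(τ) = R(e^{2πiτ})` (LNM 1752 Ch. 3 p. 27),
  identifying the `q`-series `ramanujanP/Q/R` of `NesterenkoModularScope.lean` with Mathlib's
  `EisensteinSeries.E2` and `ModularForm.E₄`, `ModularForm.E₆` through Mathlib's `q`-expansions
  `EisensteinSeries.E2_eq_tsum_cexp`, `EisensteinSeries.q_expansion_bernoulli`.
* `ramanujanP_exp_neg_two_pi` (`= 3/π`, from `E₂(i) = 3/π`,
  `Literature.NumberTheory.EllipticCurves.ModularForms.E2_I`), `ramanujanR_exp_neg_two_pi` (`= 0`,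
  from `E₆(i) = 0`, `….ModularForms.E₆_I`), `ramanujanQ_exp_neg_two_pi` (`= 3Γ(1/4)⁸/(2π)⁶`, from
  `E₄(i) = 3Γ(1/4)⁸/(2π)⁶`, `….ModularForms.E₄_I`, i.e. Hurwitz's evaluation of `g₂(ℤi + ℤ)` via
  the lemniscatic period `Γ(1/4)²/(2√(2π))`, `Literature/NumberTheory/EllipticCurves/EisensteinValuesAtI.lean`
  and `Literature/Analysis/SpecialFunctions/LemniscateConstant.lean`).
* `ramanujan_values_exp_neg_two_pi_holds` — **the discharge**.
* `nesterenko_of_thm_1_1'` — Corollary 1.2 (`Literature.NumberTheory.Transcendental.nesterenko`)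
  from Theorem 1.1 ALONE; `nesterenko_of_mainCriterion'` — from the current trust base of
  Theorem 1.1 (`Philippon1986_mainCriterion`, `NesterenkoPhilippon2001_ch3_lemma_3_4`,
  `NesterenkoPhilippon2001_ch3_thm_2_3`; `NesterenkoModularScopeCriterionProofs.lean`).

## References

* [NesterenkoPhilippon2001] Yu. V. Nesterenko, P. Philippon (eds.), *Introduction to Algebraic
  Independence Theory*, LNM 1752, Springer 2001, Ch. 3 §1 p. 27 (PDF p. 39): the functions
  `P, Q, R`, "`E₂(τ) = P(e^{2πiτ}), E₄(τ) = Q(e^{2πiτ}), E₆(τ) = R(e^{2πiτ})`", Theorem 1.1, the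
  values at `e^{−2π}` and Corollary 1.2; Ch. 1 §3 Remark ii (PDF p. 19).
* [Nesterenko1996SbMath] Yu. V. Nesterenko, *Modular functions and transcendence questions*,
  Sb. Math. 187 (1996) 1319–1348, Theorem 1 and its corollaries.
-/

noncomputable section

open UpperHalfPlane hiding I
open Complex EisensteinSeries ModularForm
open Literature.NumberTheory.EllipticCurves.ModularForms
open scoped ArithmeticFunction.sigma MatrixGroups Real

namespace Literature.Barriers.Schanuel

/-! ### `P, Q, R` are the `q`-expansions of `E₂, E₄, E₆` -/

/-- **`E₂(τ) = P(e^{2πiτ})`** (LNM 1752 Ch. 3 p. 27; Mathlib's `E2_eq_tsum_cexp`).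
[cite: NesterenkoPhilippon2001, Ch. 3 §1 p. 27 (PDF p. 39)] -/
theorem ramanujanP_cexp (τ : ℍ) :
    ramanujanP (cexp (2 * π * I * τ)) = E2 τ := by
  rw [E2_eq_tsum_cexp, ramanujanP,
    tsum_pnat_eq_tsum_succ (f := fun n : ℕ => (σ 1 n : ℂ) * cexp (2 * π * I * τ) ^ n)]

/-- **`E₄(τ) = Q(e^{2πiτ})`** (LNM 1752 Ch. 3 p. 27; Mathlib's `q_expansion_bernoulli` with
`B₄ = −1/30`, `−2·4/B₄ = 240`). [cite: NesterenkoPhilippon2001, Ch. 3 §1 p. 27 (PDF p. 39)] -/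
theorem ramanujanQ_cexp (τ : ℍ) :
    ramanujanQ (cexp (2 * π * I * τ)) = E₄ τ := by
  have h := EisensteinSeries.q_expansion_bernoulli (by norm_num : 3 ≤ 4) (by decide) τ
  have hb : bernoulli 4 = -1 / 30 := by
    rw [bernoulli_eq_bernoulli'_of_ne_one (by norm_num), bernoulli'_four]
  simp_rw [zpow_natCast] at h
  rw [show E₄ τ = E (by norm_num : 3 ≤ 4) τ from rfl, h, hb, ramanujanQ,
    tsum_pnat_eq_tsum_succ (f := fun n : ℕ => (σ 3 n : ℂ) * cexp (2 * π * I * τ) ^ n)]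
  push_cast
  ring

/-- **`E₆(τ) = R(e^{2πiτ})`** (LNM 1752 Ch. 3 p. 27; Mathlib's `q_expansion_bernoulli` with
`B₆ = 1/42`, `−2·6/B₆ = −504`). [cite: NesterenkoPhilippon2001, Ch. 3 §1 p. 27 (PDF p. 39)] -/
theorem ramanujanR_cexp (τ : ℍ) :
    ramanujanR (cexp (2 * π * I * τ)) = E₆ τ := by
  have h := EisensteinSeries.q_expansion_bernoulli (by norm_num : 3 ≤ 6) (by decide) τ
  have hb : bernoulli 6 = 1 / 42 := by
    rw [bernoulli_eq_bernoulli'_of_ne_one (by norm_num), PeriodPair.bernoulli'_six]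
  simp_rw [zpow_natCast] at h
  rw [show E₆ τ = E (by norm_num : 3 ≤ 6) τ from rfl, h, hb, ramanujanR,
    tsum_pnat_eq_tsum_succ (f := fun n : ℕ => (σ 5 n : ℂ) * cexp (2 * π * I * τ) ^ n)]
  push_cast
  ring

/-! ### The values at `q = e^{−2π}` (`τ = i`) -/

/-- **`P(e^{−2π}) = 3/π`** (`= E₂(i)`). [cite: NesterenkoPhilippon2001, Ch. 3 §1 p. 27 (PDF p. 39)] -/
theorem ramanujanP_exp_neg_two_pi :
    ramanujanP ((Real.exp (-(2 * π)) : ℝ) : ℂ) = 3 / (π : ℂ) := by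
  rw [← cexp_two_pi_I_I, ramanujanP_cexp, E2_I]

/-- **`Q(e^{−2π}) = 3Γ(1/4)⁸/(2π)⁶`** (`= E₄(i)`).
[cite: NesterenkoPhilippon2001, Ch. 3 §1 p. 27 (PDF p. 39)] -/
theorem ramanujanQ_exp_neg_two_pi :
    ramanujanQ ((Real.exp (-(2 * π)) : ℝ) : ℂ) =
      3 * (Real.Gamma (1 / 4) : ℂ) ^ 8 / (2 * (π : ℂ)) ^ 6 := by
  rw [← cexp_two_pi_I_I, ramanujanQ_cexp, E₄_I]

/-- **`R(e^{−2π}) = 0`** (`= E₆(i)`). [cite: NesterenkoPhilippon2001, Ch. 3 §1 p. 27 (PDF p. 39)] -/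
theorem ramanujanR_exp_neg_two_pi :
    ramanujanR ((Real.exp (-(2 * π)) : ℝ) : ℂ) = 0 := by
  rw [← cexp_two_pi_I_I, ramanujanR_cexp]
  exact E₆_I

/-- **Discharge of the named fact `ramanujan_values_exp_neg_two_pi`**: `P(e^{−2π}) = 3/π`,
`Q(e^{−2π}) = 3Γ(1/4)⁸/(2π)⁶`, `R(e^{−2π}) = 0`.
[cite: NesterenkoPhilippon2001, Ch. 3 §1 p. 27 (PDF p. 39)] -/
theorem ramanujan_values_exp_neg_two_pi_holds : ramanujan_values_exp_neg_two_pi :=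
  ⟨ramanujanP_exp_neg_two_pi, ramanujanQ_exp_neg_two_pi, ramanujanR_exp_neg_two_pi⟩

/-! ### Corollary 1.2 (`π, e^π, Γ(1/4)`) from Theorem 1.1 alone -/

/-- **Corollary 1.2 from Theorem 1.1 alone**: with the values at `e^{−2π}` discharged, the tree's
`Literature.NumberTheory.Transcendental.nesterenko` (`π, e^π, Γ(1/4)` algebraically independent)
follows from Nesterenko's Theorem 1.1 (`nesterenko1996_thm_1_1`) and nothing else.
[cite: NesterenkoPhilippon2001, Ch. 3 Corollary 1.2 (PDF p. 39)] -/
theorem nesterenko_of_thm_1_1' (h1 : nesterenko1996_thm_1_1) :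
    Literature.NumberTheory.Transcendental.nesterenko :=
  nesterenko_of_thm_1_1 h1 ramanujan_values_exp_neg_two_pi_holds

/-- **Corollary 1.2 from the current trust base of Theorem 1.1** — Philippon's Théorème 2.11,
LNM 1752 Ch. 3 Lemma 3.4 and Theorem 2.3 (`nesterenko1996_thm_1_1_of_mainCriterion`).
[cite: NesterenkoPhilippon2001, Ch. 3 Corollary 1.2 and §2 (PDF pp. 39, 43)] -/
theorem nesterenko_of_mainCriterion'
    (hmain : Literature.NumberTheory.Transcendental.Philippon1986_mainCriterion)
    (h34 : NesterenkoPhilippon2001_ch3_lemma_3_4) (h23 : NesterenkoPhilippon2001_ch3_thm_2_3) :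
    Literature.NumberTheory.Transcendental.nesterenko :=
  nesterenko_of_thm_1_1' (nesterenko1996_thm_1_1_of_mainCriterion hmain h34 h23)

end Literature.Barriers.Schanuel

end
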